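import Mathlib
import HarnessLib
import Summits.Parity.BatemanHorn.Theses.RoughValueTransport
import Summits.Parity.BatemanHorn.Theorems.RoughValueTransportRoughValueLawIffRatioLaws
import Summits.Parity.BatemanHorn.Theorems.RoughValueTransportRoughValueLawStrength

/-!
# STRATEGY CENSUS — typed companion (crux stmt-Parity-11390 `RoughValueTransport.RoughValueLaw`)

Strategist work file (planner-cstrat-stmt-Parity-11390-p1-0, 2026-08-17). No `sorry`.
It records, as elaborated Lean, the typed objects quoted in `STRATEGY-CENSUS.md`:

* §D4 — the split of the crux BY DEGREE CLASS (`RVLDegLeTwo ∧ RVLDegGeThree ↔ RoughValueLaw`,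
  trivial glue) and the kernel-checked reason the first leaf is summit-class
  (`batemanHorn_degLeTwo_of_leaf` = the tree's strength certificate p108123 restated on the leaf);
* §D5 — the split EXISTENCE ∧ SHAPE-GIVEN-EXISTENCE (`DensitiesExist`, `ShapeOfDensities`,
  glue `roughValueLaw_of_exist_of_shape`, converse `exist_of_roughValueLaw`);
* §D1 — pointers (`#check`) to the LANDED normal form `roughValueLaw_iff_ratioLaws` (p92159) whose
  two hypotheses are the ready-made children `DeepRatioLaw` / `ShallowRatioLaw` of a
  `route edit --split … --glue-by roughValueLaw_of_ratioLaws`.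

Nothing here is filed as an item; the census explains why none of these splits is executed.
-/

open Filter Finset Polynomial Asymptotics
open scoped Topology

namespace Summit.Parity.BatemanHorn.Cruxes.RoughValueLaw.Census

open Literature.NumberTheory.Sieve
open Summit.Parity.BatemanHorn.Theses.RoughValueTransport (RoughValueLaw)

/-- The inline Buchstab predicate of the crux. -/
def IsBuchstab (ω : ℝ → ℝ) : Prop :=
  (∀ u : ℝ, 1 ≤ u → u ≤ 2 → ω u = u⁻¹) ∧ ContinuousOn ω (Set.Ici 1) ∧
    (∀ u : ℝ, 2 < u → HasDerivAt (fun t : ℝ => t * ω t) (ω (u - 1)) u)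

/-- `Φ_f(x,u) (log x)^k / x`, the crux's normalised rough-value count. -/
noncomputable def ratio {k : ℕ} (f : Fin k → ℤ[X]) (u : ℝ) (x : ℕ) : ℝ :=
  (((Finset.Icc 1 x).filter (fun n : ℕ => ∀ i, 0 < (f i).eval (n : ℤ) ∧
    ∀ p ∈ Finset.range ⌈(x : ℝ) ^ (((f i).natDegree : ℝ) / u)⌉₊,
      p.Prime → ¬ ((p : ℤ) ∣ (f i).eval (n : ℤ)))).card : ℝ) * Real.log x ^ k / (x : ℝ)

/-- The crux's conclusion for ONE system and ONE `ω`. -/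
def Conclusion {k : ℕ} (f : Fin k → ℤ[X]) (ω : ℝ → ℝ) : Prop :=
  ∃ A : ℝ, ∀ u : ℝ, 2 < u → Tendsto (ratio f u) atTop (𝓝 (A * (u * ω u) ^ k))

theorem roughValueLaw_iff :
    RoughValueLaw ↔ ∀ (k : ℕ) (f : Fin k → ℤ[X]), IsBatemanHornSystem f →
      ∀ ω, IsBuchstab ω → Conclusion f ω :=
  Iff.rfl

/-! ### §D4 — split by degree class -/

/-- Leaf 1: the crux restricted to systems all of whose coordinates have degree `≤ 2`
(linear `k`-tuples, quadratics, mixed). -/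
def RVLDegLeTwo : Prop :=
  ∀ (k : ℕ) (f : Fin k → ℤ[X]), IsBatemanHornSystem f → (∀ i, (f i).natDegree ≤ 2) →
    ∀ ω, IsBuchstab ω → Conclusion f ω

/-- Leaf 2: the crux restricted to systems with SOME coordinate of degree `≥ 3`. -/
def RVLDegGeThree : Prop :=
  ∀ (k : ℕ) (f : Fin k → ℤ[X]), IsBatemanHornSystem f → (∃ i, 3 ≤ (f i).natDegree) →
    ∀ ω, IsBuchstab ω → Conclusion f ω

/-- Trivial glue of §D4. -/
theorem roughValueLaw_iff_degSplit : RoughValueLaw ↔ RVLDegLeTwo ∧ RVLDegGeThree := by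
  rw [roughValueLaw_iff]
  constructor
  · intro h
    exact ⟨fun k f hf _ ω hω => h k f hf ω hω, fun k f hf _ ω hω => h k f hf ω hω⟩
  · rintro ⟨h₂, h₃⟩ k f hf ω hω
    by_cases hdeg : ∀ i, (f i).natDegree ≤ 2
    · exact h₂ k f hf hdeg ω hω
    · push Not at hdeg
      obtain ⟨i, hi⟩ := hdeg
      exact h₃ k f hf ⟨i, by omega⟩ ω hω

/-- WHY LEAF 1 IS SUMMIT-CLASS (kernel-checked): it alone proves Bateman–Horn for every system of
degree `≤ 2` — the tree's strength certificate (p108123) needs the crux only at such systems. -/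
theorem batemanHorn_degLeTwo_of_leaf (h : RVLDegLeTwo) :
    ∀ (k : ℕ) (f : Fin k → ℤ[X]), IsBatemanHornSystem f → (∀ i, (f i).natDegree ≤ 2) →
      BatemanHornAsymptotic f :=
  fun k f hf hdeg => Strength.batemanHornAsymptotic_of_systemRoughValueLaw hf hdeg (h k f hf hdeg)

/-- In particular leaf 1 ALONE proves the Hardy–Littlewood twin asymptotic and the twin prime
conjecture (through the tree's `Strength` corollaries, which consume the crux only at `(X, X+2)`). -/
theorem twinPrimeCount_isEquivalent_of_leaf (h : RVLDegLeTwo) :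
    (fun x : ℕ => (twinPrimeCount x : ℝ)) ~[atTop]
      fun x : ℕ => 2 * twinPrimeConst * x / Real.log x ^ 2 :=
  Strength.twinPrimeCount_isEquivalent_of_systemRoughValueLaw
    (h 2 twinSystem isBatemanHornSystem_twinSystem Strength.natDegree_twinSystem_le_two)

theorem twinPrimes_of_leaf (h : RVLDegLeTwo) : TwinPrimeConjecture := by
  have hC2 : 0 < twinPrimeConst := twinPrimeConst_pos_holds
  refine twinPrimeConjecture_of_tendsto
    ((twinPrimeCount_isEquivalent_of_leaf h).symm.tendsto_atTop ?_)
  have := tendsto_natCast_div_log_sq_atTop.const_mul_atTop (mul_pos two_pos hC2)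
  simpa [mul_div_assoc] using this

/-! ### §D5 — split EXISTENCE ∧ SHAPE-GIVEN-EXISTENCE -/

/-- Leaf E: the rough-value DENSITIES exist at every depth `u > 2` (no shape asserted). -/
def DensitiesExist : Prop :=
  ∀ (k : ℕ) (f : Fin k → ℤ[X]), IsBatemanHornSystem f →
    ∀ u : ℝ, 2 < u → ∃ L : ℝ, Tendsto (ratio f u) atTop (𝓝 L)

/-- Leaf S: IF all densities of a system exist, they have Buchstab's shape with one constant. -/
def ShapeOfDensities : Prop :=
  ∀ (k : ℕ) (f : Fin k → ℤ[X]), IsBatemanHornSystem f →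
    (∀ u : ℝ, 2 < u → ∃ L : ℝ, Tendsto (ratio f u) atTop (𝓝 L)) →
      ∀ ω, IsBuchstab ω → Conclusion f ω

/-- Glue of §D5 (trivial logic). -/
theorem roughValueLaw_of_exist_of_shape (hE : DensitiesExist) (hS : ShapeOfDensities) :
    RoughValueLaw :=
  (roughValueLaw_iff).2 fun k f hf ω hω => hS k f hf (hE k f hf) ω hω

/-- Converse bookkeeping: the crux gives leaf E (instantiate at `buchstabOmega`). -/
theorem exist_of_roughValueLaw (h : RoughValueLaw) : DensitiesExist := by
  intro k f hf u hu
  have hω : IsBuchstab buchstabOmega :=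
    ⟨fun _ h1 h2 => buchstabOmega_eq_inv h1 h2, continuousOn_buchstabOmega,
      fun _ hu' => hasDerivAt_mul_buchstabOmega hu'⟩
  obtain ⟨A, hA⟩ := (roughValueLaw_iff).1 h k f hf buchstabOmega hω
  exact ⟨_, hA u hu⟩

theorem shape_of_roughValueLaw (h : RoughValueLaw) : ShapeOfDensities :=
  fun k f hf _ ω hω => (roughValueLaw_iff).1 h k f hf ω hω

theorem roughValueLaw_iff_exist_and_shape : RoughValueLaw ↔ DensitiesExist ∧ ShapeOfDensities :=
  ⟨fun h => ⟨exist_of_roughValueLaw h, shape_of_roughValueLaw h⟩,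
    fun h => roughValueLaw_of_exist_of_shape h.1 h.2⟩

/-! ### §D1 — the landed deep/shallow normal form (children ready-made for `--glue-by`) -/

#check @Summit.Parity.BatemanHorn.Cruxes.RoughValueLaw.IncrementAnchoring.roughValueLaw_iff_ratioLaws
#check @Summit.Parity.BatemanHorn.Cruxes.RoughValueLaw.IncrementAnchoring.roughValueLaw_of_ratioLaws

end Summit.Parity.BatemanHorn.Cruxes.RoughValueLaw.Census
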